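import Mathlib
import Summits.NavierStokesRegularity.NavierStokesRegularity.Theorems.ThreadingFluxHorizonTowerZonalAlgebra
import Summits.NavierStokesRegularity.NavierStokesRegularity.Theorems.ThreadingFluxHorizonTowerZonalBridge
import HarnessLib
/-!
# Crux `PoloidalLiouville` (stmt-NavierStokesRegularity-1222, wall W1), crux idea «horizon-threading-tower» (ns-idea-15):
# ALL-DEGREE horizon zonality, kernel part F4 — the complex-coordinate dictionary `θ`

Support file (Theorems-side tooling; seat ns-wall-eng-5 g4, cell ns-wall-extremal, W1 adjunct; `--supports stmt-NavierStokesRegularity-1222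
--as helper`).  Memo of record: pub/ns-wall-extremal/ARM-B/zonal-eng5/PROOF-HZSD-ALL-L.md (DATUM B-w5.8; paper proof critic-replicated by
ns-wall-crit-1 g2 2026-08-28T22:52:10Z); one-file kernel proof AllDev-HorizonZonalitySingleDegree.lean 53719c2c2d5f6cf4 of which this is a slice.

Content (kernel plan F4): the substitution `theta : ℂ[x₀,x₁,x₂] → ℂ[W,V,Z]`, `x₀ ↦ (W+V)/2`, `x₁ ↦ −i(W−V)/2`, `x₂ ↦ Z` (so `W = x₀ + i x₁ = w`,
`V = w̄`, `Z = z`), its chain rule (`pderiv_bind₁`, `pderiv_*_theta`) and the TRANSPORT IDENTITIES between the real operators of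
`ThreadingFluxHorizonTowerZonalBridge.lean` and the complex-coordinate operators of `ThreadingFluxHorizonTowerZonalAlgebra.lean`:
`lapC_theta` (`Δ̃∘θ = θ∘Δ`), `dotC_theta`, `lam_theta` (`Λ∘θ = −C(i)·θ∘L`), `tripleC_theta` (memo (1.1): `tripleC = −i·det(∇·,∇·,x)`),
`detC_theta` (`D̃∘θ = −C(i)·θ∘D`).  Pure polynomial algebra.

HONEST LABEL: a lemma toward / part of the kernel proof of the crux-idea obstruction `HorizonTower.HorizonZonalitySingleDegree` (all `l`);
`PoloidalLiouville` (1222), `UnthreadedRigidity` (27585), the NS-dynamics levers `OrderTwoHorizonLaw(Blowdown)` and NS regularity remain OPEN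
and untouched; W1/W2 movement 0.  [folklore]
-/

-- the summit and its single problem share the name (D-0017 nested layout)
set_option linter.dupNamespace false

noncomputable section

open MvPolynomial Finsupp

namespace Summit.NavierStokesRegularity.NavierStokesRegularity.Theorems.PoloidalLiouville.HorizonTower.Zonal

/-! ### The complex-coordinate dictionary `θ` (memo §1 (1.1)) -/

section Theta

open Complex

/-- The complex coordinates as linear forms: `x₀ = (W + V)/2`, `x₁ = −i(W − V)/2`, `x₂ = Z`. -/
def thetaFun : Fin 3 → CPoly := ![C (1 / 2 : ℂ) * (X 0 + X 1), C (-I / 2) * (X 0 - X 1), X 2]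

/-- `θ(x₀) = (W + V)/2`. [folklore] -/
@[simp] theorem thetaFun_zero : thetaFun 0 = C (1 / 2 : ℂ) * (X 0 + X 1) := rfl
/-- `θ(x₁) = −i(W − V)/2`. [folklore] -/
@[simp] theorem thetaFun_one : thetaFun 1 = C (-I / 2) * (X 0 - X 1) := rfl
/-- `θ(x₂) = Z`. [folklore] -/
@[simp] theorem thetaFun_two : thetaFun 2 = X 2 := rfl

/-- The change of variables `θ : ℂ[x₀,x₁,x₂] → ℂ[W,V,Z]`, `p ↦ p((W+V)/2, −i(W−V)/2, Z)`. -/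
def theta : MvPolynomial (Fin 3) ℂ →ₐ[ℂ] CPoly := bind₁ thetaFun

/-- **Chain rule** for a polynomial substitution. [folklore] -/
theorem pderiv_bind₁ (g : Fin 3 → CPoly) (k : Fin 3) (q : MvPolynomial (Fin 3) ℂ) :
    pderiv k (bind₁ g q) = ∑ j : Fin 3, bind₁ g (pderiv j q) * pderiv k (g j) := by
  classical
  induction q using MvPolynomial.induction_on with
  | C a => simp
  | add p q hp hq => simp only [map_add, hp, hq, add_mul, Finset.sum_add_distrib]
  | mul_X p i hp =>
    have hterm : ∀ j : Fin 3, bind₁ g (pderiv j (p * X i)) * pderiv k (g j)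
        = bind₁ g (pderiv j p) * pderiv k (g j) * g i + (if j = i then bind₁ g p * pderiv k (g i) else 0) := by
      intro j
      rw [pderiv_mul, map_add, map_mul, map_mul, bind₁_X_right]
      by_cases hji : j = i
      · subst hji
        rw [pderiv_X_self, map_one, if_pos rfl]; ring
      · rw [pderiv_X_of_ne (fun h => hji h.symm), map_zero, if_neg hji]; ring
    rw [map_mul, bind₁_X_right, pderiv_mul, hp, Finset.sum_mul, Finset.sum_congr rfl (fun j _ => hterm j),
      Finset.sum_add_distrib, Finset.sum_ite_eq' Finset.univ i, if_pos (Finset.mem_univ i)]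

/-- `∂_W θ(x₀) = 1/2`. [folklore] -/
theorem pderiv_zero_thetaFun_zero : pderiv 0 (thetaFun 0) = C (1 / 2 : ℂ) := by
  rw [thetaFun_zero, pderiv_C_mul, map_add, pderiv_X_self, pderiv_X_of_ne (by decide), add_zero, mul_one]
/-- `∂_W θ(x₁) = −i/2`. [folklore] -/
theorem pderiv_zero_thetaFun_one : pderiv 0 (thetaFun 1) = C (-I / 2) := by
  rw [thetaFun_one, pderiv_C_mul, map_sub, pderiv_X_self, pderiv_X_of_ne (by decide), sub_zero, mul_one]
/-- `∂_W θ(x₂) = 0`. [folklore] -/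
theorem pderiv_zero_thetaFun_two : pderiv 0 (thetaFun 2) = 0 := by
  rw [thetaFun_two, pderiv_X_of_ne (by decide)]
/-- `∂_V θ(x₀) = 1/2`. [folklore] -/
theorem pderiv_one_thetaFun_zero : pderiv 1 (thetaFun 0) = C (1 / 2 : ℂ) := by
  rw [thetaFun_zero, pderiv_C_mul, map_add, pderiv_X_self, pderiv_X_of_ne (by decide), zero_add, mul_one]
/-- `∂_V θ(x₁) = i/2`. [folklore] -/
theorem pderiv_one_thetaFun_one : pderiv 1 (thetaFun 1) = -C (-I / 2) := by
  rw [thetaFun_one, pderiv_C_mul, map_sub, pderiv_X_self, pderiv_X_of_ne (by decide), zero_sub, mul_neg, mul_one]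
/-- `∂_V θ(x₂) = 0`. [folklore] -/
theorem pderiv_one_thetaFun_two : pderiv 1 (thetaFun 2) = 0 := by
  rw [thetaFun_two, pderiv_X_of_ne (by decide)]
/-- `∂_Z θ(x₀) = 0`. [folklore] -/
theorem pderiv_two_thetaFun_zero : pderiv 2 (thetaFun 0) = 0 := by
  rw [thetaFun_zero, pderiv_C_mul, map_add, pderiv_X_of_ne (by decide), pderiv_X_of_ne (by decide), add_zero, mul_zero]
/-- `∂_Z θ(x₁) = 0`. [folklore] -/
theorem pderiv_two_thetaFun_one : pderiv 2 (thetaFun 1) = 0 := by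
  rw [thetaFun_one, pderiv_C_mul, map_sub, pderiv_X_of_ne (by decide), pderiv_X_of_ne (by decide), sub_zero, mul_zero]
/-- `∂_Z θ(x₂) = 1`. [folklore] -/
theorem pderiv_two_thetaFun_two : pderiv 2 (thetaFun 2) = 1 := by
  rw [thetaFun_two, pderiv_X_self]

/-- `C(−i/2) = −C(1/2)·C(i)` in the polynomial ring. -/
theorem C_negI_half : (C (-I / 2) : CPoly) = -(C (1 / 2 : ℂ) * C I) := by
  rw [← C_mul, ← C_neg]; congr 1; ring

/-- `C(i)² = −1` in the polynomial ring. -/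
theorem C_I_mul_C_I : (C I : CPoly) * C I = -1 := by
  rw [← C_mul, I_mul_I, C_neg, C_1]

/-- Chain rule: `∂_W(θq) = ½(θ∂₀q − i θ∂₁q)`. [folklore] -/
theorem pderiv_zero_theta (q : MvPolynomial (Fin 3) ℂ) :
    pderiv 0 (theta q) = C (1 / 2 : ℂ) * (theta (pderiv 0 q) - C I * theta (pderiv 1 q)) := by
  rw [theta, pderiv_bind₁, Fin.sum_univ_three, pderiv_zero_thetaFun_zero, pderiv_zero_thetaFun_one,
    pderiv_zero_thetaFun_two, C_negI_half]
  ring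

/-- Chain rule: `∂_V(θq) = ½(θ∂₀q + i θ∂₁q)`. [folklore] -/
theorem pderiv_one_theta (q : MvPolynomial (Fin 3) ℂ) :
    pderiv 1 (theta q) = C (1 / 2 : ℂ) * (theta (pderiv 0 q) + C I * theta (pderiv 1 q)) := by
  rw [theta, pderiv_bind₁, Fin.sum_univ_three, pderiv_one_thetaFun_zero, pderiv_one_thetaFun_one,
    pderiv_one_thetaFun_two, C_negI_half]
  ring

/-- Chain rule: `∂_Z(θq) = θ∂₂q`. [folklore] -/
theorem pderiv_two_theta (q : MvPolynomial (Fin 3) ℂ) : pderiv 2 (theta q) = theta (pderiv 2 q) := by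
  rw [theta, pderiv_bind₁, Fin.sum_univ_three, pderiv_two_thetaFun_zero, pderiv_two_thetaFun_one,
    pderiv_two_thetaFun_two]
  ring

/-- `θ(x₀) = (W + V)/2`. [folklore] -/
theorem theta_X_zero : theta (X 0) = C (1 / 2 : ℂ) * (X 0 + X 1) := by rw [theta, bind₁_X_right, thetaFun_zero]
/-- `θ(x₁) = −(1/2)·i·(W − V)`. [folklore] -/
theorem theta_X_one : theta (X 1) = -(C (1 / 2 : ℂ) * C I) * (X 0 - X 1) := by
  rw [theta, bind₁_X_right, thetaFun_one, C_negI_half]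
/-- `θ(x₂) = Z`. [folklore] -/
theorem theta_X_two : theta (X 2) = X 2 := by rw [theta, bind₁_X_right, thetaFun_two]

/-- Dictionary: `θ` intertwines the flat Laplacian with `Δ̃ = 4∂_W∂_V + ∂_Z²`. -/
theorem lapC_theta (q : MvPolynomial (Fin 3) ℂ) : lapC (theta q) = theta (lapP q) := by
  unfold lapC lapP
  rw [pderiv_one_theta, pderiv_C_mul, map_add, pderiv_zero_theta, pderiv_mul, pderiv_C, zero_mul, zero_add,
    pderiv_zero_theta, pderiv_two_theta, pderiv_two_theta, pderiv_comm 1 0 q]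
  simp only [map_add]
  have h4 : (C (4 : ℂ) : CPoly) * C (1 / 2 : ℂ) * C (1 / 2 : ℂ) = 1 := by rw [← C_mul, ← C_mul, ← C_1]; congr 1; norm_num
  linear_combination (-(theta (pderiv 1 (pderiv 1 q)))) * C_I_mul_C_I
    + (theta (pderiv 0 (pderiv 0 q)) - C I * C I * theta (pderiv 1 (pderiv 1 q))) * h4

/-- Dictionary: `θ` intertwines the gradient pairings: `dotC (θa) (θb) = θ(∇a·∇b)`. -/
theorem dotC_theta (a b : MvPolynomial (Fin 3) ℂ) : dotC (theta a) (theta b) = theta (dotP a b) := by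
  unfold dotC dotP
  rw [pderiv_zero_theta, pderiv_zero_theta, pderiv_one_theta, pderiv_one_theta, pderiv_two_theta, pderiv_two_theta]
  simp only [map_add, map_mul]
  have h2 : (C (2 : ℂ) : CPoly) * C (1 / 2 : ℂ) * C (1 / 2 : ℂ) = C (1 / 2 : ℂ) := by rw [← C_mul, ← C_mul]; congr 1; norm_num
  have h2' : (C (1 / 2 : ℂ) : CPoly) + C (1 / 2 : ℂ) = 1 := by rw [← C_add, ← C_1]; congr 1; norm_num
  linear_combination (-(theta (pderiv 1 a) * theta (pderiv 1 b))) * C_I_mul_C_I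
    + (2 * (theta (pderiv 0 a) * theta (pderiv 0 b)) - 2 * C I * C I * (theta (pderiv 1 a) * theta (pderiv 1 b))) * h2
    + (theta (pderiv 0 a) * theta (pderiv 0 b) - C I * C I * (theta (pderiv 1 a) * theta (pderiv 1 b))) * h2'

/-- Dictionary: `Λ(θa) = −C(i)·θ(L a)` with `L = x₀∂₁ − x₁∂₀` (the weight operator is `−i` times the rotation generator). -/
theorem lam_theta (a : MvPolynomial (Fin 3) ℂ) : lam (theta a) = -C I * theta (rotP a) := by
  unfold lam rotP
  rw [pderiv_zero_theta, pderiv_one_theta]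
  simp only [map_sub, map_mul, theta_X_zero, theta_X_one]
  linear_combination (C (1 / 2 : ℂ) * (X 0 - X 1) * theta (pderiv 0 a)) * C_I_mul_C_I

/-- Dictionary (memo (1.1)): `tripleC (θa) (θb) = −C(i)·θ(det(∇a, ∇b, x))`. -/
theorem tripleC_theta (a b : MvPolynomial (Fin 3) ℂ) : tripleC (theta a) (theta b) = -C I * theta (detP a b) := by
  unfold tripleC detP
  rw [show (C (2 : ℂ) : CPoly) = 2 from map_ofNat C 2, lam_theta, lam_theta, pderiv_two_theta, pderiv_two_theta,
    pderiv_zero_theta, pderiv_one_theta, pderiv_zero_theta, pderiv_one_theta]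
  unfold rotP
  simp only [map_add, map_sub, map_mul, theta_X_two]
  have h22 : (2 : CPoly) * C (1 / 2 : ℂ) = 1 := by
    rw [show (2 : CPoly) = C (2 : ℂ) from (map_ofNat C 2).symm, ← C_mul, ← C_1]; congr 1; norm_num
  linear_combination (C I * X 2 * (theta (pderiv 1 a) * theta (pderiv 0 b) - theta (pderiv 0 a) * theta (pderiv 1 b))
    * (2 * C (1 / 2 : ℂ) + 1)) * h22

/-- Dictionary: `D̃(θq) = −C(i)·θ(D(q))`. -/
theorem detC_theta (q : MvPolynomial (Fin 3) ℂ) : detC (theta q) = -C I * theta (DP q) := by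
  rw [detC, dotC_theta, tripleC_theta, DP]

end Theta

end Summit.NavierStokesRegularity.NavierStokesRegularity.Theorems.PoloidalLiouville.HorizonTower.Zonal

end
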